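import Summits.BirchSwinnertonDyer.BirchSwinnertonDyer.Theorems.KimAtThreeD7uTamagawaSharpLocal
import Summits.BirchSwinnertonDyer.BirchSwinnertonDyer.Theorems.KimAtThreeD7uTamagawaDefectTamDiv
import Summits.BirchSwinnertonDyer.Rank1Residual.GaloisImage.KolyvaginInjectivityAllDepths
import Summits.BirchSwinnertonDyer.Rank1Residual.Additive.GordCycLowerBoundOfControlTamagawaSharp
import HarnessLib

/-!
# The TAMAGAWA-DIVISIBLE bad places, XVII: SHARPNESS of the Kolyvagin-system-level Tamagawa defect —
# the push-forward `incl_* : KS(E[p^{j+1}], 𝓕_can, 𝒫) ↪ KS(E[p^{k+1}], 𝓕_u, 𝒫)` beyond `max_w v_p(c_w)`,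
# and the EXACT THRESHOLD `KS(E[3^{k+1}], 𝓕_u, 𝒫) = 0 ⟺ ∃ ℓ ≠ 3, 3^{k+1} ∣ c_ℓ`
# (cell `bsd-addord`, seat w2-tamdiv gen 6; route W2 `KimAtThreeKolyvagin`, items 19562 / 19679 / 19599 /
# 19560, «TamDiv∞» at Kolyvagin-system level — «several Tamagawa primes at once» settled in the negative)

HONEST FRAMING: TOOL theorems (no definition, no named fact, no `sorry`); closes nothing by itself;
nothing is booked; BSD is not proved by any of this.  §5–§6 hold for EVERY prime `p` and every reduction
type, with displayed binders only (a finite `T ⊇ {p} ∪ bad`, Kolyvagin data with the SAME primes outside `T`,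
cyclotomic transverse conditions, THE canonical comparison maps for ONE `η`; for §6 also «no `Γ_ℚ`-fixed
point on `E[p^k·p]`» and ONE non-zero Kolyvagin system at the lower level).  §7 (`p = 3`) is conditional on
exactly the binders of part XV plus that non-zero Kolyvagin system of `(E[3], 𝓕_can)` (core rank one).

## What and why

Parts IX–XV: `3^{k+1} ∣ c_ℓ` for ONE `ℓ` ⇒ `KS(E[3^{k+1}], 𝓕_u, 𝒫) = 0` for [MR04] Remark A.5's structure
`𝓕_u = blochKatoSelmerStructure p (tateTorsionDatum W p k) ⊤` (Büyükboduk 2009 Thm. 3.1 / Cor. 3.3 for `T₃E`),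
listing «several Tamagawa primes at once (`v₃(∏ c_ℓ)`)» as not done.  Here:

* §5 **`isKolyvaginSystem_map_torsionInclusion_blochKatoRelaxed`** (every `p`, `j ≤ k`): if
  `p^{v_p(c_w)} ∣ p^{k-j}` at every finite `w ∤ p` — i.e. `k - j ≥ max_w v_p(c_w)` — then for every
  Kolyvagin system `κ` of `(E[p^j·p], 𝓕_can, D_j)` the family `d ↦ incl_* κ_d` is a Kolyvagin system of
  `(E[p^k·p], 𝓕_u, D_k)` (n1011-p15's push-forward `KSDevissage.isKolyvaginSystem_map` fed by part XVI:
  local conditions `p^{k-j}·𝓕_can(w)_k ⊆ 𝓕_u(w)_k`, functorial transverse conditions, TRANSPORT of the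
  canonical comparison maps along `incl`); subgroup form `map_torsionInclusion_mem_kolyvaginSystems_…`.
* §6 **`kolyvaginSystems_blochKatoRelaxed_ne_bot_of_exists_ne_zero`**: `incl_*` is injective (no
  `Γ_ℚ`-fixed points), so a non-zero Kolyvagin system of `(E[p^j·p], 𝓕_can)` gives
  **`KS(E[p^k·p], 𝓕_u, D_k) ≠ 0`** whenever `k - j ≥ max_w v_p(c_w)`; the supplier of the non-zero system is
  core rank one (`exists_isKolyvaginSystem_ne_zero_of_isFreeRankOneZMod` from Sakamoto's conclusion shape).
* §7 (`p = 3`) **`kolyvaginSystems_blochKatoRelaxed_eq_bot_iff_exists_pow_succ_dvd`**: under part XV's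
  binders plus ONE non-zero Kolyvagin system of `(E[3], 𝓕_can, D 0)`:
  **`KS(E[3^k·3], 𝓕_u, D k) = 0 ⟺ ∃ ℓ ∤ 3, 3^{k+1} ∣ c_ℓ`** — the EXACT THRESHOLD is `max_ℓ v₃(c_ℓ)`.

READING (for the W2 rows 19562 / 19679 / 19599 with `3 ∣ ∏ c_ℓ`): the Kolyvagin-system-MODULE form of
«TamDiv∞» delivers divisibility of every Kolyvagin system for `𝓕_u` — in particular of the Kolyvagin
derivative classes of a Kato-type Euler system (part III) — by `3^{max_ℓ v₃(c_ℓ)}`, and by NO higher power: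
two Tamagawa primes with `3 ∥ c_{ℓ₁}`, `3 ∥ c_{ℓ₂}` give `9 ∣ ∏ c_ℓ` but `KS(E[9], 𝓕_u, 𝒫) ⊇ incl_* KS(E[3],
𝓕_can, 𝒫) ≠ 0`.  The product form `κ^{Kato} ∈ (∏_ℓ c_ℓ)·KS(T_pE)` is Büyükboduk's Question 1 (JNT 129
(2009) §4.2; §1: «a further improvement which shall include all Tamagawa factors unfortunately escapes our
method»), OPEN in print; it is a property of Kato's system beyond its unramifiedness, not of the module.
Rows with exactly one `ℓ` having `3 ∣ c_ℓ` are unaffected (`max = v₃(∏)`).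

References: K. Büyükboduk, JNT 129 (2009) §1, Thm. 3.1, Cor. 3.3, §4.2 Questions 1–2; B. Mazur, K. Rubin,
Mem. AMS 799 (2004) Prop. 6.2.6, App. A Remark A.5, Thm. 4.4.1; R. Sakamoto, JTNB 36 (2024) Def. 4.1,
Thm. 4.4 (1); K. Rubin, PCMI 18 (2011) Def. 1.9.6, Def. 2.2.1; R. Greenberg, LNM 1716 §2.
-/

noncomputable section

-- the cell's Theorems namespace `Summit.BirchSwinnertonDyer.BirchSwinnertonDyer.…` repeats the summit name by design (D-0017)
set_option linter.dupNamespace false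

open scoped Classical NumberField ContRepresentation
open Function Field NumberField IsDedekindDomain Module
open WeierstrassCurve Literature.NumberTheory.EllipticCurves Literature.NumberTheory.GaloisRepresentations
  Literature.NumberTheory.GaloisRepresentations.DiscreteGaloisModule Literature.NumberTheory.GaloisCohomology
open Summit.BirchSwinnertonDyer.Rank1Residual Summit.BirchSwinnertonDyer.Rank1Residual.GaloisImage
open Summit.BirchSwinnertonDyer.BirchSwinnertonDyer.Theorems.KimAtThreeD7uTamagawaIndex

namespace Summit.BirchSwinnertonDyer.BirchSwinnertonDyer.Theorems.KimAtThreeD7uTamagawaSharp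

/-! ### §5 The push-forward `incl_* : KS(E[p^{j+1}], 𝓕_can, 𝒫) → KS(E[p^{k+1}], 𝓕_u, 𝒫)` -/

section PushForward

open Summit.BirchSwinnertonDyer.Rank1Residual.GaloisImage.KSDevissage

variable (W : WeierstrassCurve ℚ) [W.IsElliptic] (p : ℕ) [hp : Fact p.Prime] {j k : ℕ}

omit hp in
/-- At a GOOD place `q ∤ p` the torsion module `E[p^k·p]` is unramified (Néron–Ogg–Shafarevich, easy
direction; tree `smul_geomTorsion_eq_of_mem_inertia`). [cite: SilvermanAEC2009, Prop. VII.4.1(a)] -/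
theorem isUnramifiedAt_torsionGaloisModule_of_hasGoodReductionAt (k : ℕ) {q : HeightOneSpectrum (𝓞 ℚ)}
    (hpq : ((p : ℕ) : 𝓞 ℚ) ∉ q.asIdeal) (hgood : W.HasGoodReductionAt q) :
    GaloisRep.IsUnramifiedAt q (W.torsionGaloisModule ((p : ℤ) ^ k * (p : ℤ))) := by
  have hn : (((p : ℤ) ^ k * (p : ℤ) : ℤ) : 𝓞 ℚ) ∉ q.asIdeal := by
    rw [← pow_succ, Int.cast_pow, Int.cast_natCast]
    exact fun h => hpq (q.isPrime.mem_of_pow_mem (k + 1) h)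
  exact fun 𝔓 h𝔓 τ hτ => LinearMap.ext fun P => W.smul_geomTorsion_eq_of_mem_inertia hgood hn h𝔓 hτ P

/-- **THE PUSH-FORWARD `incl_* : KS(E[p^{j+1}], 𝓕_can, 𝒫) → KS(E[p^{k+1}], 𝓕_u, 𝒫)`** (every prime `p`,
every `j ≤ k`, every reduction type).  Let `W/ℚ` be elliptic and suppose `p^{v_p(c_w)} ∣ p^{k-j}` at every
finite `w ∤ p` (i.e. `k - j ≥ max_w v_p(c_w)`: `p^{k-j}` kills every component group `Φ_w[p^∞]`).  Let `T`
be a finite set of finite places containing those above `p` and the bad ones, `D_j`, `D_k` Kolyvagin data on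
`E[p^j·p]`, `E[p^k·p]` with the SAME primes, all outside `T`, cyclotomic transverse conditions and THE
canonical comparison maps for ONE family of primitive roots `η` (levels `p^{j+1}`, `p^{k+1}`).  Then for
every Kolyvagin system `κ` of `(E[p^j·p], 𝓕_can = propagatedSelmerStructure W p j, D_j)` the family
`d ↦ incl_* κ_d` is a Kolyvagin system of `(E[p^k·p], 𝓕_u, D_k)` for [MR04] Remark A.5's unramified
structure `𝓕_u = blochKatoSelmerStructure p (tateTorsionDatum W p k) ⊤` (relaxed above `p`) — the structure
of parts III/XV, for which a Kato-type Euler system yields Kolyvagin systems and whose Kolyvagin systems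
all VANISH when `p^{k+1}` divides ONE Tamagawa number.  Assembly: n1011-p15 `KSDevissage.isKolyvaginSystem_map`
with part XVI's local lemma (`hF`), `localMap_mem_cyclotomicTransverse` (`hT`) and part XVI's transport of
the canonical comparison maps along `incl` (`hfs`, matched bases from `exists_bases_red_of_le`).
[cite: MazurRubin2004, Prop. 6.2.6 (p. 75) and App. A Remark A.5 (p. 81)]
[cite: Buyukboduk2009TamagawaDefect, §1 (p. 3: «only one Tamagawa factor») and §4.2 Questions 1–2]
[cite: Sakamoto2024, Def. 4.1 (p. 926)] -/
theorem isKolyvaginSystem_map_torsionInclusion_blochKatoRelaxed (hjk : j ≤ k)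
    (htam : ∀ w : HeightOneSpectrum (𝓞 ℚ), ((p : ℕ) : 𝓞 ℚ) ∉ w.asIdeal →
      p ^ padicValNat p ((W.baseChange (w.adicCompletion ℚ)).localTamagawaNumber
        (w.adicCompletionIntegers ℚ)) ∣ p ^ (k - j))
    (T : Finset (HeightOneSpectrum (𝓞 ℚ)))
    (hpT : ∀ v : HeightOneSpectrum (𝓞 ℚ), ((p : ℕ) : 𝓞 ℚ) ∈ v.asIdeal → v ∈ T)
    (hbadT : ∀ v : HeightOneSpectrum (𝓞 ℚ), ¬ W.HasGoodReductionAt v → v ∈ T)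
    {Dj : KolyvaginDatum (W.torsionGaloisModule ((p : ℤ) ^ j * (p : ℤ)))}
    {Dk : KolyvaginDatum (W.torsionGaloisModule ((p : ℤ) ^ k * (p : ℤ)))}
    (hP : Dk.primes = Dj.primes) (hPT : ∀ q ∈ Dj.primes, q ∉ T)
    (hTj : Dj.transverse = cyclotomicTransverse _) (hTk : Dk.transverse = cyclotomicTransverse _)
    {η : (q : HeightOneSpectrum (𝓞 ℚ)) → (ZMod (Ideal.absNorm q.asIdeal))ˣ}
    (hDj : Dj.HasCanonicalComparison (p ^ (j + 1)) η) (hDk : Dk.HasCanonicalComparison (p ^ (k + 1)) η)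
    {κ : Finset (HeightOneSpectrum (𝓞 ℚ)) →
      galoisCohomology (W.torsionGaloisModule ((p : ℤ) ^ j * (p : ℤ))) 1}
    (hκ : Dj.IsKolyvaginSystem (propagatedSelmerStructure W p j) κ) :
    Dk.IsKolyvaginSystem (blochKatoSelmerStructure p (tateTorsionDatum W p k) (fun _ _ => ⊤))
      (fun d => galoisCohomology.map (W.torsionInclusion (pow_mul_dvd_pow_mul_of_le p hjk)) 1 (κ d)) := by
  classical
  haveI : NeZero (p ^ (k + 1)) := ⟨pow_ne_zero _ hp.out.ne_zero⟩
  haveI : Fact (1 < p ^ (j + 1)) := ⟨Nat.one_lt_pow (Nat.succ_ne_zero _) hp.out.one_lt⟩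
  have hgood : ∀ q ∈ Dj.primes, ((p : ℕ) : 𝓞 ℚ) ∉ q.asIdeal ∧ W.HasGoodReductionAt q := fun q hq =>
    ⟨fun h => hPT q hq (hpT q h), by by_contra h; exact hPT q hq (hbadT q h)⟩
  -- the reduction `red : E[p^k·p] → E[p^j·p]`, `x ↦ p^{k-j} x`, and matched bases
  obtain ⟨red, hred⟩ := exists_torsionReduction_pow_mul W p j k
  obtain ⟨n, b, b', hb⟩ := exists_bases_red_of_le W p hjk red hred
  refine isKolyvaginSystem_map (W.torsionInclusion (pow_mul_dvd_pow_mul_of_le p hjk)) hP ?_ ?_ ?_ ?_ hκ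
  · -- `𝓕_can` on `E[p^j·p]` is unramified at the (good) Kolyvagin primes
    intro q hq
    exact (propagatedSelmerStructure_inr_eq_unramifiedSubgroup W p j (hgood q hq).1 (hgood q hq).2).le
  · -- the local conditions (part XVI §2)
    intro v y hy
    exact localMap_torsionInclusion_mem_blochKatoSelmerStructure W p hjk htam v hy
  · -- the transverse conditions are functorial
    intro q hq y hy
    rw [hTj] at hy
    rw [hTk]
    exact localMap_mem_cyclotomicTransverse _ q hy
  · -- the canonical comparison maps are transported along `incl` (part XVI §3)
    intro q hq y hy w hw
    have hqk : q ∈ Dk.primes := by rw [hP]; exact hq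
    exact singularMap_localMap_incl_eq_fs_of_hasCanonicalComparison (pow_dvd_pow p (Nat.succ_le_succ hjk))
      red b b' hb (W.torsionInclusion (pow_mul_dvd_pow_mul_of_le p hjk)) hDk hDj hqk hq
      (isUnramifiedAt_torsionGaloisModule_of_hasGoodReductionAt W p k (hgood q hq).1 (hgood q hq).2)
      (isUnramifiedAt_torsionGaloisModule_of_hasGoodReductionAt W p j (hgood q hq).1 (hgood q hq).2) hy w hw

/-- **Subgroup form**: under the hypotheses of `isKolyvaginSystem_map_torsionInclusion_blochKatoRelaxed`,
post-composition with `incl_*` maps the group `KS(E[p^j·p], 𝓕_can, D_j)` into `KS(E[p^k·p], 𝓕_u, D_k)`.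
[cite: MazurRubin2004, App. A Remark A.5 (p. 81)] [cite: Sakamoto2024, Def. 4.1 (p. 926)] -/
theorem map_torsionInclusion_mem_kolyvaginSystems_blochKatoRelaxed (hjk : j ≤ k)
    (htam : ∀ w : HeightOneSpectrum (𝓞 ℚ), ((p : ℕ) : 𝓞 ℚ) ∉ w.asIdeal →
      p ^ padicValNat p ((W.baseChange (w.adicCompletion ℚ)).localTamagawaNumber
        (w.adicCompletionIntegers ℚ)) ∣ p ^ (k - j))
    (T : Finset (HeightOneSpectrum (𝓞 ℚ)))
    (hpT : ∀ v : HeightOneSpectrum (𝓞 ℚ), ((p : ℕ) : 𝓞 ℚ) ∈ v.asIdeal → v ∈ T)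
    (hbadT : ∀ v : HeightOneSpectrum (𝓞 ℚ), ¬ W.HasGoodReductionAt v → v ∈ T)
    {Dj : KolyvaginDatum (W.torsionGaloisModule ((p : ℤ) ^ j * (p : ℤ)))}
    {Dk : KolyvaginDatum (W.torsionGaloisModule ((p : ℤ) ^ k * (p : ℤ)))}
    (hP : Dk.primes = Dj.primes) (hPT : ∀ q ∈ Dj.primes, q ∉ T)
    (hTj : Dj.transverse = cyclotomicTransverse _) (hTk : Dk.transverse = cyclotomicTransverse _)
    {η : (q : HeightOneSpectrum (𝓞 ℚ)) → (ZMod (Ideal.absNorm q.asIdeal))ˣ}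
    (hDj : Dj.HasCanonicalComparison (p ^ (j + 1)) η) (hDk : Dk.HasCanonicalComparison (p ^ (k + 1)) η)
    {κ : Finset (HeightOneSpectrum (𝓞 ℚ)) →
      galoisCohomology (W.torsionGaloisModule ((p : ℤ) ^ j * (p : ℤ))) 1}
    (hκ : κ ∈ Dj.kolyvaginSystems (propagatedSelmerStructure W p j)) :
    (fun d => galoisCohomology.map (W.torsionInclusion (pow_mul_dvd_pow_mul_of_le p hjk)) 1 (κ d)) ∈
      Dk.kolyvaginSystems (blochKatoSelmerStructure p (tateTorsionDatum W p k) (fun _ _ => ⊤)) :=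
  (KolyvaginDatum.mem_kolyvaginSystems_iff _ _ _).mpr
    (isKolyvaginSystem_map_torsionInclusion_blochKatoRelaxed W p hjk htam T hpT hbadT hP hPT hTj hTk hDj hDk
      ((KolyvaginDatum.mem_kolyvaginSystems_iff _ _ _).mp hκ))

/-! ### §6 SHARPNESS: `KS(E[p^{k+1}], 𝓕_u, 𝒫) ≠ 0` beyond `max_w v_p(c_w)` -/

/-- A group FREE OF RANK ONE over `ℤ/N` with `1 < N` has a non-zero element (the image of `1`); bridge from
Sakamoto's conclusion shape `KolyvaginSystem.IsFreeRankOneZMod (KS) N` ([S24] Thm. 4.4 (1), the route's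
`Sakamoto2024.kolyvaginSystems_freeRankOne_zmod_three_pow`; n1011 `CoreRankOne.isFreeRankOneZMod_…`) to the
hypothesis `hne` below. [cite: Sakamoto2024, Thm. 4.4 (1) (p. 926)] -/
theorem exists_isKolyvaginSystem_ne_zero_of_isFreeRankOneZMod {K : Type} [Field K] [NumberField K]
    {M : Type} [AddCommGroup M] [TopologicalSpace M] [DiscreteTopology M] {ρ : DiscreteGaloisModule K M}
    {D : KolyvaginDatum ρ} {𝓕 : SelmerStructure ρ} {N : ℕ} (hN : 1 < N)
    (h : KolyvaginSystem.IsFreeRankOneZMod (D.kolyvaginSystems 𝓕) N) :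
    ∃ κ : Finset (HeightOneSpectrum (𝓞 K)) → galoisCohomology ρ 1, D.IsKolyvaginSystem 𝓕 κ ∧ κ ≠ 0 := by
  obtain ⟨e⟩ := h
  haveI : Fact (1 < N) := ⟨hN⟩
  refine ⟨(e.symm 1).1, (KolyvaginDatum.mem_kolyvaginSystems_iff _ _ _).mp (e.symm 1).2, fun h0 => ?_⟩
  have h1 : e.symm 1 = 0 := Subtype.ext h0
  exact one_ne_zero ((e.symm.injective (h1.trans (map_zero e.symm).symm)))

omit [W.IsElliptic] hp in
/-- **`incl_*` is injective on Kolyvagin systems**: if `E[p^k·p]` has no `Γ_ℚ`-fixed point and the pushed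
system `d ↦ incl_* κ_d` vanishes, so does `κ`. [cite: GreenbergLNM1716, §2 p. 63] -/
theorem eq_zero_of_map_torsionInclusion_eq_zero (hjk : j ≤ k)
    (h0 : ∀ P : geomTorsion W ((p : ℤ) ^ k * (p : ℤ)),
      (∀ σ : absoluteGaloisGroup ℚ, W.torsionGaloisModule ((p : ℤ) ^ k * (p : ℤ)) σ P = P) → P = 0)
    {κ : Finset (HeightOneSpectrum (𝓞 ℚ)) →
      galoisCohomology (W.torsionGaloisModule ((p : ℤ) ^ j * (p : ℤ))) 1}
    (hκ : (fun d => galoisCohomology.map (W.torsionInclusion (pow_mul_dvd_pow_mul_of_le p hjk)) 1 (κ d)) = 0) :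
    κ = 0 := by
  funext d
  exact map_torsionInclusion_injective_of_le W p hjk h0 ((congrFun hκ d).trans (map_zero _).symm)

/-- **SHARPNESS of the module-level Tamagawa defect («TamDiv∞» captures `max_w v_p(c_w)`, never
`v_p(∏ c_w)`).**  Under the hypotheses of `isKolyvaginSystem_map_torsionInclusion_blochKatoRelaxed`
(`p^{v_p(c_w)} ∣ p^{k-j}` at every finite `w ∤ p`) and with no `Γ_ℚ`-fixed point on `E[p^k·p]`: if
`(E[p^j·p], 𝓕_can, D_j)` carries a NON-ZERO Kolyvagin system (core rank one: [MR04] Thm. 4.? / Sakamoto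
2024 Thm. 4.4 (1) at `p = 3`), then **`KS(E[p^k·p], 𝓕_u, D_k) ≠ 0`**.  So the vanishing
`KS(E[3^{k+1}], 𝓕_u, 𝒫) = 0` of part XV holds for `k + 1 ≤ max_ℓ v₃(c_ℓ)` and FAILS for every larger `k`:
with two Tamagawa primes `3 ∥ c_{ℓ₁}`, `3 ∥ c_{ℓ₂}` one has `9 ∣ ∏ c_ℓ` but `KS(E[9], 𝓕_u, 𝒫) ⊇ incl_*
KS(E[3], 𝓕_can, 𝒫) ≠ 0` — the «several Tamagawa primes at once» form of TamDiv∞ is FALSE at the level of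
the module of Kolyvagin systems; for `κ^{Kato}` itself it is Büyükboduk's Question 1, open in print.
[cite: Buyukboduk2009TamagawaDefect, §1 (p. 3) and §4.2 Questions 1–2 (p. 12)]
[cite: MazurRubin2004, Prop. 6.2.6 (p. 75) and App. A Remark A.5 (p. 81)] -/
theorem kolyvaginSystems_blochKatoRelaxed_ne_bot_of_exists_ne_zero (hjk : j ≤ k)
    (htam : ∀ w : HeightOneSpectrum (𝓞 ℚ), ((p : ℕ) : 𝓞 ℚ) ∉ w.asIdeal →
      p ^ padicValNat p ((W.baseChange (w.adicCompletion ℚ)).localTamagawaNumber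
        (w.adicCompletionIntegers ℚ)) ∣ p ^ (k - j))
    (h0 : ∀ P : geomTorsion W ((p : ℤ) ^ k * (p : ℤ)),
      (∀ σ : absoluteGaloisGroup ℚ, W.torsionGaloisModule ((p : ℤ) ^ k * (p : ℤ)) σ P = P) → P = 0)
    (T : Finset (HeightOneSpectrum (𝓞 ℚ)))
    (hpT : ∀ v : HeightOneSpectrum (𝓞 ℚ), ((p : ℕ) : 𝓞 ℚ) ∈ v.asIdeal → v ∈ T)
    (hbadT : ∀ v : HeightOneSpectrum (𝓞 ℚ), ¬ W.HasGoodReductionAt v → v ∈ T)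
    {Dj : KolyvaginDatum (W.torsionGaloisModule ((p : ℤ) ^ j * (p : ℤ)))}
    {Dk : KolyvaginDatum (W.torsionGaloisModule ((p : ℤ) ^ k * (p : ℤ)))}
    (hP : Dk.primes = Dj.primes) (hPT : ∀ q ∈ Dj.primes, q ∉ T)
    (hTj : Dj.transverse = cyclotomicTransverse _) (hTk : Dk.transverse = cyclotomicTransverse _)
    {η : (q : HeightOneSpectrum (𝓞 ℚ)) → (ZMod (Ideal.absNorm q.asIdeal))ˣ}
    (hDj : Dj.HasCanonicalComparison (p ^ (j + 1)) η) (hDk : Dk.HasCanonicalComparison (p ^ (k + 1)) η)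
    (hne : ∃ κ : Finset (HeightOneSpectrum (𝓞 ℚ)) →
        galoisCohomology (W.torsionGaloisModule ((p : ℤ) ^ j * (p : ℤ))) 1,
      Dj.IsKolyvaginSystem (propagatedSelmerStructure W p j) κ ∧ κ ≠ 0) :
    Dk.kolyvaginSystems (blochKatoSelmerStructure p (tateTorsionDatum W p k) (fun _ _ => ⊤)) ≠ ⊥ := by
  obtain ⟨κ, hκ, hκ0⟩ := hne
  intro hbot
  have hmem := map_torsionInclusion_mem_kolyvaginSystems_blochKatoRelaxed W p hjk htam T hpT hbadT hP hPT
    hTj hTk hDj hDk ((KolyvaginDatum.mem_kolyvaginSystems_iff _ _ _).mpr hκ)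
  rw [hbot, AddSubgroup.mem_bot] at hmem
  exact hκ0 (eq_zero_of_map_torsionInclusion_eq_zero W p hjk h0 hmem)

end PushForward

/-! ### §7 `p = 3`: the EXACT THRESHOLD `KS(E[3^{k+1}], 𝓕_u, 𝒫) = 0 ⟺ ∃ ℓ ≠ 3, 3^{k+1} ∣ c_ℓ` -/

section Three

open Summit.BirchSwinnertonDyer.BirchSwinnertonDyer.Theorems.KimAtThreeD7uTamagawaDefectDevissage

variable (W : WeierstrassCurve ℚ) [W.IsElliptic]

/-- **THE EXACT THRESHOLD of the Kolyvagin-system-level Tamagawa defect at `p = 3`.**  Binders: those of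
part XV (`KimAtThreeD7uTamagawaDefectTamDiv.kolyvaginSystems_blochKatoRelaxed_eq_bot_of_pow_succ_dvd`: the
Poitou–Tate family `inv`, `hEP`, `T ⊇ {3} ∪ bad`, no `Γ_ℚ`-fixed points on any `E[3^j·3]`, `τ` with
(H.2)-shape cokernels, canonical admissible Kolyvagin data `D j` on every `E[3^j·3]` with ONE prime set
`P ⊆ 𝒫_{3^{k+1}}` outside `T`, cyclotomic transverse conditions, ONE `η`, the level-one prime choice
`hprime`) plus ONE more: `(E[3], 𝓕_can, D 0)` carries a non-zero Kolyvagin system (`hne`; core rank one,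
Sakamoto 2024 Thm. 4.4 (1) / [MR04] Thm. 4.4.1).  CONCLUSION: for [MR04] Remark A.5's structure
`𝓕_u = blochKatoSelmerStructure 3 (tateTorsionDatum W 3 k) ⊤`,
**`KS(E[3^k·3], 𝓕_u, D k) = 0 ⟺ 3^{k+1} ∣ c_ℓ for SOME finite `ℓ ∤ 3`**.  (⇐) is part XV (one Tamagawa
prime suffices); (⇒): if no `c_ℓ` is divisible by `3^{k+1}` then `v₃(c_w) ≤ k` everywhere and §6 exhibits
`incl_* KS(E[3], 𝓕_can, D 0) ≠ 0` inside.  So the Kolyvagin-system form of «TamDiv∞» is governed by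
`max_ℓ v₃(c_ℓ)`, NOT by `v₃(∏ c_ℓ)`: the «several Tamagawa primes at once» strengthening is false at module
level (Büyükboduk's Question 1 for `κ^{Kato}` itself remains open in print).
[cite: Buyukboduk2009TamagawaDefect, Thm. 3.1, Cor. 3.3 and §4.2 Questions 1–2 (p. 12)]
[cite: MazurRubin2004, Prop. 6.2.6 (p. 75) and App. A Remark A.5 (p. 81)] -/
theorem kolyvaginSystems_blochKatoRelaxed_eq_bot_iff_exists_pow_succ_dvd [Finite (geomTorsion W ((3 : ℕ) : ℤ))]
    [Finite (geomTorsion W (((3 : ℕ) : ℤ) ^ 0 * ((3 : ℕ) : ℤ)))]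
    {inv : LocalInvariants ℚ 3}
    (hperf : inv.IsPerfect) (hsum : inv.SumLocalTermEqZero) (hcompl : inv.SelmerComplement)
    (hEP : ∀ v : HeightOneSpectrum (𝓞 ℚ), localEulerPoincareCharacteristic (v.adicCompletion ℚ))
    (T : Finset (HeightOneSpectrum (𝓞 ℚ)))
    (h3T : ∀ v : HeightOneSpectrum (𝓞 ℚ), ((3 : ℕ) : 𝓞 ℚ) ∈ v.asIdeal → v ∈ T)
    (hbadT : ∀ v : HeightOneSpectrum (𝓞 ℚ), ¬ W.HasGoodReductionAt v → v ∈ T) (k : ℕ)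
    (h0 : ∀ (j : ℕ) (P : geomTorsion W (((3 : ℕ) : ℤ) ^ j * ((3 : ℕ) : ℤ))),
      (∀ σ : absoluteGaloisGroup ℚ,
        W.torsionGaloisModule (((3 : ℕ) : ℤ) ^ j * ((3 : ℕ) : ℤ)) σ P = P) → P = 0)
    {Sset : Set (HeightOneSpectrum (𝓞 ℚ))} {τ : absoluteGaloisGroup ℚ}
    (hτ : ∀ j : ℕ, Nonempty (cokerSubOne (W.torsionGaloisModule (((3 : ℕ) : ℤ) ^ j * ((3 : ℕ) : ℤ))) τ ≃+
      ZMod (3 ^ (j + 1))))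
    (hτ₁ : Nonempty (cokerSubOne (W.torsionGaloisModule ((3 : ℕ) : ℤ)) τ ≃+ ZMod 3))
    (hτμ : τ ∈ rootsOfUnityFixer ℚ (3 ^ (k + 1)))
    (D : (j : ℕ) → KolyvaginDatum (W.torsionGaloisModule (((3 : ℕ) : ℤ) ^ j * ((3 : ℕ) : ℤ))))
    {P : Set (HeightOneSpectrum (𝓞 ℚ))} (hP : ∀ j, (D j).primes = P) (hPT : ∀ q ∈ P, q ∉ T)
    (hPc : P ⊆ frobeniusClassPrimes
      (W.torsionGaloisModule (((3 : ℕ) : ℤ) ^ k * ((3 : ℕ) : ℤ))) Sset τ (3 ^ (k + 1)))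
    (hT : ∀ j, (D j).transverse = cyclotomicTransverse _)
    {η : (q : HeightOneSpectrum (𝓞 ℚ)) → (ZMod (Ideal.absNorm q.asIdeal))ˣ}
    (hD : ∀ j, (D j).HasCanonicalComparison (3 ^ (j + 1)) η) (hadm : ∀ j, (D j).IsAdmissible)
    (hprime : ∀ c : galoisCohomology (W.torsionGaloisModule (((3 : ℕ) : ℤ) ^ 0 * ((3 : ℕ) : ℤ))) 1, c ≠ 0 →
      ∀ c' : galoisCohomology (DiscreteGaloisModule.tateDual
        (W.torsionGaloisModule (((3 : ℕ) : ℤ) ^ 0 * ((3 : ℕ) : ℤ))) 3) 1, c' ≠ 0 →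
      {q ∈ (D 0).primes |
        galoisCohomology.localization (W.torsionGaloisModule (((3 : ℕ) : ℤ) ^ 0 * ((3 : ℕ) : ℤ)))
          (Sum.inr q) 1 c ≠ 0 ∧
        galoisCohomology.localization (DiscreteGaloisModule.tateDual
          (W.torsionGaloisModule (((3 : ℕ) : ℤ) ^ 0 * ((3 : ℕ) : ℤ))) 3) (Sum.inr q) 1 c' ≠ 0}.Infinite)
    (hne : ∃ κ : Finset (HeightOneSpectrum (𝓞 ℚ)) →
        galoisCohomology (W.torsionGaloisModule (((3 : ℕ) : ℤ) ^ 0 * ((3 : ℕ) : ℤ))) 1,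
      (D 0).IsKolyvaginSystem (propagatedSelmerStructure W 3 0) κ ∧ κ ≠ 0) :
    (D k).kolyvaginSystems (blochKatoSelmerStructure 3 (tateTorsionDatum W 3 k) (fun _ _ => ⊤)) = ⊥ ↔
      ∃ ℓ : HeightOneSpectrum (𝓞 ℚ), ((3 : ℕ) : 𝓞 ℚ) ∉ ℓ.asIdeal ∧
        3 ^ (k + 1) ∣ (W.baseChange (ℓ.adicCompletion ℚ)).localTamagawaNumber (ℓ.adicCompletionIntegers ℚ) := by
  haveI : Fact (Nat.Prime 3) := ⟨Nat.prime_three⟩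
  constructor
  · -- (⇒): if no Tamagawa number is divisible by `3^{k+1}`, `incl_* KS(E[3], 𝓕_can) ≠ 0` sits inside
    intro hbot
    by_contra hno
    refine kolyvaginSystems_blochKatoRelaxed_ne_bot_of_exists_ne_zero W 3 (Nat.zero_le k) ?_ (h0 k) T h3T
      hbadT ((hP k).trans (hP 0).symm) (fun q hq => hPT q ((hP 0) ▸ hq)) (hT 0) (hT k) (hD 0) (hD k) hne hbot
    intro w hw
    rw [Nat.sub_zero]
    refine pow_dvd_pow 3 ?_
    have hlt : ¬ 3 ^ (k + 1) ∣
        (W.baseChange (w.adicCompletion ℚ)).localTamagawaNumber (w.adicCompletionIntegers ℚ) :=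
      fun h => hno ⟨w, hw, h⟩
    rw [padicValNat_dvd_iff_le (Additive.localTamagawaNumber_adicCompletion_ne_zero W w)] at hlt
    omega
  · -- (⇐): part XV, one Tamagawa prime suffices
    rintro ⟨ℓ, h3ℓ, hk⟩
    exact kolyvaginSystems_blochKatoRelaxed_eq_bot_of_pow_succ_dvd W hperf hsum hcompl hEP T h3T hbadT h3ℓ k
      hk h0 hτ hτ₁ hτμ D hP hPT hPc hT hD hadm hprime

end Three

end Summit.BirchSwinnertonDyer.BirchSwinnertonDyer.Theorems.KimAtThreeD7uTamagawaSharp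

end
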